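import Literature.NumberTheory.Rogawski1990.OneDimAutRepH
import Literature.RepresentationTheory.HarrisKudlaSweet1996.SplittingCharactersCM
import HarnessLib

/-!
# D5 sequel · the archimedean type of a one-dimensional automorphic `ξ` of `H = U(2) × U(1)` EXISTS AND IS UNIQUE
# (the fields `harchη`∕`harchψ` of ★ `OneDimAutRepH` are derivable) — REF1 (g3)'s (J8) discharged

For the base change `χ = η̃` of an AUTOMORPHIC character `η` of the norm-one torus `T(𝔸_{L⁺})` of a CM field `L` (★ `OneDimAutRepH.bcη`,
★ `TorusDict.pullback`): `χ` is unitary (★ `OneDimAutRepH.unit_η`, automorphic ⇒ unitary on the anisotropic torus) and trivial on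
`𝕀_{L⁺}` (★ `OneDimAutRepH.bcη_ideleBaseChange`), i.e. a splitting character for `m = 0` in the tree's ★
`HarrisKudlaSweet1996.IsSplittingChar` currency; hence by ★ `IsSplittingChar.exists_hasUnitaryArchType` ([Liu2021, Remark 4.2]: existence of
the weight, with the parity `e_w ≡ m (mod 2)`) it has a unitary archimedean type `(e, 0)` with every `e_w` EVEN — `(2e′, 0)` — and by ★
`hasUnitaryArchType_zero_unique` that type is unique.  Consequences typed here:

* `exists_hasUnitaryArchType_two_mul`, `eq_of_hasUnitaryArchType_two_mul` (any unitary `χ` with `χ|_{𝕀_{L⁺}} = 1`);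
* `OneDimAutRepH.isUnitary_bcη`∕`_bcψ`, `isSplittingChar_zero_bcη`∕`_bcψ`, **`eη_unique`∕`eψ_unique`** (the chosen types of ★ D5 are canonical);
* the smart constructor **`OneDimAutRepH.ofAutomorphic η ψ hη hψ`** — a one-dimensional automorphic `ξ` from the two automorphic characters
  ALONE (the archimedean-type obligations `harchη`∕`harchψ` of the structure are discharged), with `ofAutomorphic_η`∕`_ψ` (`rfl`) and
  `eq_ofAutomorphic` (every `ξ` is `ofAutomorphic ξ.η ξ.ψ ξ.hη ξ.hψ`, by ★ `OneDimAutRepH.ext`).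

typ3 round-2 of the F0∕P3 programme (cell `hodgecm-mathlib`, crux H413), sequel of step (4) D5 (★ p811812); kept out of `OneDimAutRepH.lean` so that
D5's import cone stays the torus dictionary alone (this file adds ★ `HarrisKudlaSweet1996.SplittingCharactersCM`).  No instance, no notation,
no named fact (debt 0).

## References
[Liu2021] Remark 4.2 (the weight of a unitary Hecke character with prescribed restriction to `𝕀_{L⁺}`) · [Rogawski1990] §12.2 p. 174, §13.1 p. 199 ·
[Godement1964] §5 Thm. 4.  HC_CM is proved only modulo the printed citations until rung 0 closes. -/

set_option autoImplicit false

noncomputable section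

namespace Literature.NumberTheory.Rogawski1990

open NumberField Literature.NumberTheory.Automorphic Literature.NumberTheory.GaloisRepresentations
open Literature.NumberTheory.Automorphic.Arthur2013.Leaves.TECR
open Literature.RepresentationTheory (HarrisKudlaSweet1996.IsSplittingChar HarrisKudlaSweet1996.hasUnitaryArchType_zero_unique)

variable {L : Type} [Field L] [NumberField L] [IsCMField L]

/-! ## §1 Even unitary archimedean types: existence and uniqueness for unitary `χ` with `χ|_{𝕀_{L⁺}} = 1` -/

/-- **A unitary Hecke character of the CM field `L` trivial on `𝕀_{L⁺}` has an EVEN unitary archimedean type `(2e, 0)`** —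
`χ_w(z) = (z/|z|)^{2e_w}` at every (complex) place: ★ `IsSplittingChar.exists_hasUnitaryArchType` at `m = 0` gives a type `(e, 0)` with
`e_w ≡ 0 (mod 2)`. [cite: Liu2021, Remark 4.2] -/
theorem exists_hasUnitaryArchType_two_mul {χ : HeckeCharacter L} (hu : χ.IsUnitary)
    (hs : HarrisKudlaSweet1996.IsSplittingChar L 0 χ) :
    ∃ e : InfinitePlace L → ℤ, χ.HasUnitaryArchType (fun w => 2 * e w) (fun _ => 0) := by
  obtain ⟨e, he, hmod⟩ := hs.exists_hasUnitaryArchType hu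
  refine ⟨fun w => e w / 2, ?_⟩
  have h2 : (fun w => 2 * (e w / 2)) = e := funext fun w =>
    Int.mul_ediv_cancel' (Int.modEq_zero_iff_dvd.1 (by exact_mod_cast hmod w))
  rw [h2]
  exact he

/-- **… and the even type is UNIQUE** (★ `hasUnitaryArchType_zero_unique`: the unitary type `(e, 0)` of a unitary Hecke character is
unique; cancel the factor `2`). [cite: Liu2021, Remark 4.2] -/
theorem eq_of_hasUnitaryArchType_two_mul {χ : HeckeCharacter L} (hu : χ.IsUnitary) {e e' : InfinitePlace L → ℤ}
    (he : χ.HasUnitaryArchType (fun w => 2 * e w) (fun _ => 0)) (he' : χ.HasUnitaryArchType (fun w => 2 * e' w) (fun _ => 0)) :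
    e = e' := by
  have h := HarrisKudlaSweet1996.hasUnitaryArchType_zero_unique hu he he'
  exact funext fun w => mul_left_cancel₀ two_ne_zero (congrFun h w)

namespace OneDimAutRepH

/-! ## §2 The base changes `η̃`, `ψ̃` of a one-dimensional automorphic `ξ` -/

/-- `η̃` is unitary (`‖η̃ z‖ = ‖η (c̄ • z / z)‖ = 1`, ★ `unit_η`). [cite: Godement1964, §5 Thm. 4] -/
theorem isUnitary_bcη (ξ : OneDimAutRepH L) : ξ.bcη.IsUnitary := fun z => by
  rw [bcη_apply]
  exact ξ.unit_η _

/-- `ψ̃` is unitary. [cite: Godement1964, §5 Thm. 4] -/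
theorem isUnitary_bcψ (ξ : OneDimAutRepH L) : ξ.bcψ.IsUnitary := fun z => by
  rw [bcψ_apply]
  exact ξ.unit_ψ _

/-- `η̃|_{𝕀_{L⁺}} = 1 = ε⁰`: `η̃` is a splitting character for `m = 0` (★ `bcη_ideleBaseChange`). [cite: Rogawski1990, §12.2 p. 174] -/
theorem isSplittingChar_zero_bcη (ξ : OneDimAutRepH L) : HarrisKudlaSweet1996.IsSplittingChar L 0 ξ.bcη := fun a => by
  rw [pow_zero]
  exact ξ.bcη_ideleBaseChange a

/-- `ψ̃|_{𝕀_{L⁺}} = 1 = ε⁰`. [cite: Rogawski1990, §12.2 p. 174] -/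
theorem isSplittingChar_zero_bcψ (ξ : OneDimAutRepH L) : HarrisKudlaSweet1996.IsSplittingChar L 0 ξ.bcψ := fun a => by
  rw [pow_zero]
  exact ξ.bcψ_ideleBaseChange a

/-- **`eη` is canonical**: any even unitary type of `η̃` IS ★ `ξ.eη`. [cite: Liu2021, Remark 4.2] -/
theorem eη_unique (ξ : OneDimAutRepH L) {e : InfinitePlace L → ℤ}
    (he : ξ.bcη.HasUnitaryArchType (fun w => 2 * e w) (fun _ => 0)) : e = ξ.eη :=
  eq_of_hasUnitaryArchType_two_mul ξ.isUnitary_bcη he ξ.hasUnitaryArchType_bcη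

/-- **`eψ` is canonical**: any even unitary type of `ψ̃` IS ★ `ξ.eψ`. [cite: Liu2021, Remark 4.2] -/
theorem eψ_unique (ξ : OneDimAutRepH L) {e : InfinitePlace L → ℤ}
    (he : ξ.bcψ.HasUnitaryArchType (fun w => 2 * e w) (fun _ => 0)) : e = ξ.eψ :=
  eq_of_hasUnitaryArchType_two_mul ξ.isUnitary_bcψ he ξ.hasUnitaryArchType_bcψ

/-! ## §3 The smart constructor: `ξ` from the two automorphic characters alone -/

/-- The archimedean-type obligation of ★ `OneDimAutRepH` is automatic: for an automorphic `η` of `T(𝔸_{L⁺})` the base change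
`η̃` has an even unitary type. [cite: Liu2021, Remark 4.2] -/
theorem exists_hasUnitaryArchType_pullback (η : ↥(TorusDict.torus (IsCMField.complexConj L)) →ₜ* ℂˣ)
    (hη : TorusDict.IsAutomorphic (IsCMField.complexConj L) η) :
    ∃ e : InfinitePlace L → ℤ,
      (TorusDict.pullback (IsCMField.complexConj L) (Algebra.IsQuadraticExtension.finrank_eq_two _ L)
        (IsCMField.complexConj_ne_one (K := L)) η hη).HasUnitaryArchType (fun w => 2 * e w) (fun _ => 0) := by
  refine exists_hasUnitaryArchType_two_mul (fun z => ?_) (fun a => ?_)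
  · rw [TorusDict.pullback_apply]
    exact UnitaryGroup.norm_torusHom_apply_eq_one_of_isAutomorphic _ L _ (Algebra.IsQuadraticExtension.finrank_eq_two _ L)
      (IsCMField.complexConj_ne_one (K := L)) η hη _
  · rw [pow_zero]
    exact TorusDict.pullback_ideleBaseChange _ _ _ η hη a

/-- **A one-dimensional automorphic `ξ = (η ∘ det₀) · (ψ ∘ det)` from its two AUTOMORPHIC characters alone** (the fields `harchη`∕`harchψ`
of ★ `OneDimAutRepH` discharged by `exists_hasUnitaryArchType_pullback`). «there exist Hecke characters `η` and `ψ` of `I¹_E` such that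
`ξ(h) = η(det₀(h)) ψ(det(h))`». [cite: Rogawski1990, §13.1 p. 199] -/
def ofAutomorphic (η ψ : ↥(TorusDict.torus (IsCMField.complexConj L)) →ₜ* ℂˣ)
    (hη : TorusDict.IsAutomorphic (IsCMField.complexConj L) η) (hψ : TorusDict.IsAutomorphic (IsCMField.complexConj L) ψ) :
    OneDimAutRepH L where
  η := η
  ψ := ψ
  hη := hη
  hψ := hψ
  harchη := exists_hasUnitaryArchType_pullback η hη
  harchψ := exists_hasUnitaryArchType_pullback ψ hψ

/-- `(ofAutomorphic η ψ _ _).η = η`. [cite: Rogawski1990, §13.1 p. 199] -/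
theorem ofAutomorphic_η (η ψ : ↥(TorusDict.torus (IsCMField.complexConj L)) →ₜ* ℂˣ)
    (hη : TorusDict.IsAutomorphic (IsCMField.complexConj L) η) (hψ : TorusDict.IsAutomorphic (IsCMField.complexConj L) ψ) :
    (ofAutomorphic η ψ hη hψ).η = η := rfl

/-- `(ofAutomorphic η ψ _ _).ψ = ψ`. [cite: Rogawski1990, §13.1 p. 199] -/
theorem ofAutomorphic_ψ (η ψ : ↥(TorusDict.torus (IsCMField.complexConj L)) →ₜ* ℂˣ)
    (hη : TorusDict.IsAutomorphic (IsCMField.complexConj L) η) (hψ : TorusDict.IsAutomorphic (IsCMField.complexConj L) ψ) :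
    (ofAutomorphic η ψ hη hψ).ψ = ψ := rfl

/-- **Every `ξ` is `ofAutomorphic ξ.η ξ.ψ`** (★ `OneDimAutRepH.ext`): the structure is EXACTLY the pair of automorphic characters.
[cite: Rogawski1990, §13.1 p. 199] -/
theorem eq_ofAutomorphic (ξ : OneDimAutRepH L) : ξ = ofAutomorphic ξ.η ξ.ψ ξ.hη ξ.hψ :=
  OneDimAutRepH.ext rfl rfl

/-- `ofAutomorphic` is injective in the pair `(η, ψ)`: equal `ξ`'s have equal characters. [cite: Rogawski1990, §13.1 p. 199] -/
theorem ofAutomorphic_eq_ofAutomorphic_iff {η ψ η' ψ' : ↥(TorusDict.torus (IsCMField.complexConj L)) →ₜ* ℂˣ}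
    (hη : TorusDict.IsAutomorphic (IsCMField.complexConj L) η) (hψ : TorusDict.IsAutomorphic (IsCMField.complexConj L) ψ)
    (hη' : TorusDict.IsAutomorphic (IsCMField.complexConj L) η') (hψ' : TorusDict.IsAutomorphic (IsCMField.complexConj L) ψ') :
    ofAutomorphic η ψ hη hψ = ofAutomorphic η' ψ' hη' hψ' ↔ η = η' ∧ ψ = ψ' :=
  OneDimAutRepH.ext_iff'

end OneDimAutRepH

end Literature.NumberTheory.Rogawski1990

end
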